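import Literature.Analysis.PDE.TorusLinearSymmetricHyperbolicExistence
import Literature.Analysis.PDE.TorusSymmetricHyperbolicEnergy
import Literature.Analysis.FunctionSpaces.TorusSpaceTime
import HarnessLib

/-!
# Linear symmetric hyperbolic systems on the flat torus, III: a positive symmetriser in front of
# the time derivative (topic `Analysis/PDE`)

Analysis/PDE support file (everything proved; no definitions, no named facts). Fourth brick of
the EXISTENCE MECHANISM of the classical local theory of quasilinear symmetrisable hyperbolic
systems on `𝕋^d` (Dafermos 2005, Thm 5.1.1; Majda 1984, Thm 2.1). Part II
(`exists_torus_linear_symmHyp_solution`) solves `∂ₜw = ∑ⱼ A'ⱼ ∂ⱼw + B' w` on `ℝ × 𝕋ⁿ`; the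
linearised systems of the Picard iteration (Dafermos (5.1.10) multiplied by the symmetriser
`D²η(V)`, Majda (2.3a): `A₀(V)∂ₜU + ∑ⱼ Aⱼ(V)∂ⱼU = 0`) carry a positive definite symmetric
`A₀(t, x)` in front of `∂ₜ`. This file removes it by the classical change of unknown `u = P w`
with a **symmetriser square root** `P`: smooth operator fields `P, Q` with `Q` the pointwise
adjoint of `P` (`⟪P v, w⟫ = ⟪v, Q w⟫`) and `Q A₀ P = 1`. Then `w` solves the symmetric system
with coefficients `A'ⱼ = -Q Aⱼ P`, `B' = -Q (A₀ ∂ₜP + ∑ⱼ Aⱼ ∂ⱼP + B P)` iff `u = P w` solves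

  `A₀ ∂ₜu + ∑ⱼ Aⱼ ∂ⱼu + B u = 0`,

and **`exists_torus_linear_symmHyp_solution_of_symmetriser`** gives a global jointly smooth
solution of the latter with prescribed smooth data (Friedrichs 1954, §1, remark on the reduction
of `E ∂ₜu = …` with positive `E`; Taylor, *PDE III*, Ch. 16, (2.1)–(2.2)). The pair `(P, Q)` is
supplied by the user: for a DIAGONAL positive `A₀ = diag(aᵢ)` (the case of the Euler equations of
gas dynamics, Majda 1984 (1.16); the hard-sphere system `hsSymA0`) one takes
`P = Q = diag(aᵢ^{-1/2})`; in general `P` is a smooth Gram–Schmidt / Cholesky factor and `Q = Pᵀ`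
(not in this file).

Also recorded: `clm_comp_eq_one_comm` (one-sided inverses of operators on a finite-dimensional
space are two-sided), the joint smoothness of pointwise compositions of operator fields
(`isSmoothSpaceTimeOn_clmComp`), and the time/space Leibniz rules for `P w` on `ℝ × 𝕋ⁿ`.

## Mathlib / tree search

Tree: parts I–II of this file group; `partialDeriv_clm_apply`, `isSmooth_clm_apply`
(`TorusSymmetricHyperbolicEnergy`); `IsSmoothSpaceTimeOn.timeDerivWithin/.partialDeriv`,
`timeDerivWithin_eq_timeDeriv_of_contDiff` (`TorusSpaceTime`). Mathlib: `mul_eq_one_comm`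
(Dedekind-finiteness of `Module.End` in finite dimension), `ContDiffOn.clm_comp`,
`HasDerivAt.clm_apply`.

## References

* K. O. Friedrichs, *Symmetric hyperbolic linear differential equations*, Comm. Pure Appl.
  Math. 7 (1954) 345–392, §1. [`Friedrichs1954`]
* M. E. Taylor, *Partial Differential Equations III*, 2nd ed., Springer 2011, Ch. 16 §§1–2,
  (2.1)–(2.2) (symmetrisable systems `A₀(t,x,u)∂ₜu = …`). [`TaylorPDEIII2011`]
* A. Majda, *Compressible Fluid Flow and Systems of Conservation Laws in Several Space
  Variables*, Springer 1984, (1.16), (2.3a). [`Majda1984`]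
* C. M. Dafermos, *Hyperbolic Conservation Laws in Continuum Physics*, 2nd ed., 2005, §5.1
  (5.1.10)–(5.1.14). [`Dafermos2005`]
-/

noncomputable section

open Set Function Filter
open scoped ContDiff InnerProductSpace Topology

namespace Literature.Analysis.PDE

open Literature.Analysis.FunctionSpaces Literature.Analysis.FunctionSpaces.Torus

/-! ## Small tools -/

section Tools

variable {d : Type*} [Fintype d]
variable {W : Type*} [NormedAddCommGroup W] [NormedSpace ℝ W]
variable {F' G' H' : Type*} [NormedAddCommGroup F'] [NormedSpace ℝ F'] [NormedAddCommGroup G']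
  [NormedSpace ℝ G'] [NormedAddCommGroup H'] [NormedSpace ℝ H']

/-- **One-sided inverses of operators on a finite-dimensional space are two-sided**: if
`L (P v) = v` for all `v` then `P (L v) = v` for all `v` (Mathlib `mul_eq_one_comm` for
`Module.End`). [folklore] -/
theorem clm_comp_eq_one_comm [FiniteDimensional ℝ W] {P L : W →L[ℝ] W} (h : ∀ v, L (P v) = v)
    (v : W) : P (L v) = v := by
  have h1 : (L : W →ₗ[ℝ] W) * (P : W →ₗ[ℝ] W) = 1 := LinearMap.ext fun v => h v
  have h2 : (P : W →ₗ[ℝ] W) * (L : W →ₗ[ℝ] W) = 1 := mul_eq_one_comm.1 h1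
  have h3 := LinearMap.congr_fun h2 v
  simpa using h3

/-- Pointwise compositions of jointly smooth operator fields are jointly smooth. [folklore] -/
theorem isSmoothSpaceTimeOn_clmComp {S : Set ℝ} {G₁ : ℝ → UnitAddTorus d → (G' →L[ℝ] H')}
    {G₂ : ℝ → UnitAddTorus d → (F' →L[ℝ] G')} (h₁ : IsSmoothSpaceTimeOn S G₁)
    (h₂ : IsSmoothSpaceTimeOn S G₂) : IsSmoothSpaceTimeOn S fun t x => (G₁ t x).comp (G₂ t x) :=
  ContDiffOn.clm_comp h₁ h₂

/-- Pointwise applications of jointly smooth operator fields to jointly smooth fields are jointly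
smooth. [folklore] -/
theorem isSmoothSpaceTimeOn_clmApply {S : Set ℝ} {G₁ : ℝ → UnitAddTorus d → (F' →L[ℝ] G')}
    {w : ℝ → UnitAddTorus d → F'} (h₁ : IsSmoothSpaceTimeOn S G₁) (hw : IsSmoothSpaceTimeOn S w) :
    IsSmoothSpaceTimeOn S fun t x => G₁ t x (w t x) :=
  ContDiffOn.clm_apply h₁ hw

omit [Fintype d] in
/-- On the whole time line the one-sided time derivative is the two-sided one. [folklore] -/
theorem timeDerivWithin_univ (u : ℝ → UnitAddTorus d → F') : timeDerivWithin univ u = timeDeriv u := by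
  funext t x
  exact congr_fun (derivWithin_univ (f := fun τ => u τ x)) t

/-- Time slices of a field jointly smooth on `ℝ × 𝕋^d` are differentiable in time with derivative
`Torus.timeDeriv`. [folklore] -/
theorem hasDerivAt_slice_univ {u : ℝ → UnitAddTorus d → F'}
    (hu : IsSmoothSpaceTimeOn univ u) (t : ℝ) (x : UnitAddTorus d) :
    HasDerivAt (fun τ => u τ x) (timeDeriv u t x) t := by
  have h := (hu.hasDerivWithinAt_slice (mem_univ t) x).hasDerivAt (Filter.univ_mem)
  rwa [timeDerivWithin_univ] at h

/-- **Leibniz rule in time for `P w`** on `ℝ × 𝕋^d`: `∂ₜ(P w) = (∂ₜP) w + P ∂ₜw`. [folklore] -/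
theorem timeDeriv_clm_apply {P : ℝ → UnitAddTorus d → (F' →L[ℝ] G')}
    {w : ℝ → UnitAddTorus d → F'} (hP : IsSmoothSpaceTimeOn univ P)
    (hw : IsSmoothSpaceTimeOn univ w) (t : ℝ) (x : UnitAddTorus d) :
    timeDeriv (fun s y => P s y (w s y)) t x = timeDeriv P t x (w t x) + P t x (timeDeriv w t x) :=
  ((hasDerivAt_slice_univ hP t x).clm_apply (hasDerivAt_slice_univ hw t x)).deriv

end Tools

/-! ## The symmetrised system -/

section Symmetrised

variable {n : ℕ}
variable {W : Type*} [NormedAddCommGroup W] [InnerProductSpace ℝ W] [CompleteSpace W]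
  [FiniteDimensional ℝ W]

/-- **Linear symmetric hyperbolic systems with a positive symmetriser on the flat torus**
(Friedrichs 1954, §1; Taylor, *PDE III*, Ch. 16, (2.1)–(2.2); the linear step (5.1.10) of
Dafermos 2005, Thm 5.1.1, and (2.3a) of Majda 1984, Thm 2.1). Let
`A₀, A₁, …, Aₙ, B, P, Q : ℝ × 𝕋ⁿ → (W →L[ℝ] W)` be jointly `C^∞` operator fields on a
finite-dimensional real inner product space `W`, with `Aⱼ(t, x)` symmetric, `Q(t, x)` the adjoint
of `P(t, x)` (`⟪P v, w⟫ = ⟪v, Q w⟫`) and `Q A₀ P = 1` pointwise (so `A₀ = Q⁻¹P⁻¹` is symmetric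
positive definite and `P` is a square root of `A₀⁻¹`; e.g. `P = Q = diag(aᵢ^{-1/2})` for
`A₀ = diag(aᵢ)`). Then for every smooth `U₀ : 𝕋ⁿ → W` there is a jointly `C^∞` field
`u : ℝ × 𝕋ⁿ → W` with `u(0) = U₀` and

  `A₀(t,x) ∂ₜu + ∑ⱼ Aⱼ(t,x) ∂ⱼu + B(t,x) u = 0`  on all of `ℝ × 𝕋ⁿ`.

Proof: `u = P w` where `w` is the solution (part II) of the symmetric system
`∂ₜw = -∑ⱼ (Q Aⱼ P) ∂ⱼw - Q (A₀ ∂ₜP + ∑ⱼ Aⱼ ∂ⱼP + B P) w`, `w(0) = Q(0) A₀(0) U₀`; the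
identities `P Q A₀ = 1 = A₀ P Q` hold because one-sided inverses are two-sided in finite
dimension. [cite: Friedrichs1954, §1; TaylorPDEIII2011, Ch. 16 (2.1)–(2.2)] -/
theorem exists_torus_linear_symmHyp_solution_of_symmetriser
    {A₀ : ℝ → UnitAddTorus (Fin n) → (W →L[ℝ] W)}
    {A : Fin n → ℝ → UnitAddTorus (Fin n) → (W →L[ℝ] W)}
    {B P Q : ℝ → UnitAddTorus (Fin n) → (W →L[ℝ] W)} (hA₀ : IsSmoothSpaceTimeOn univ A₀)
    (hA : ∀ j, IsSmoothSpaceTimeOn univ (A j)) (hB : IsSmoothSpaceTimeOn univ B)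
    (hP : IsSmoothSpaceTimeOn univ P) (hQ : IsSmoothSpaceTimeOn univ Q)
    (hsym : ∀ j t x (v w : W), ⟪A j t x v, w⟫_ℝ = ⟪v, A j t x w⟫_ℝ)
    (hPQ : ∀ t x (v w : W), ⟪P t x v, w⟫_ℝ = ⟪v, Q t x w⟫_ℝ)
    (hQAP : ∀ t x (v : W), Q t x (A₀ t x (P t x v)) = v)
    {U₀ : UnitAddTorus (Fin n) → W} (hU₀ : IsSmooth U₀) :
    ∃ u : ℝ → UnitAddTorus (Fin n) → W, IsSmoothSpaceTimeOn univ u ∧ u 0 = U₀ ∧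
      ∀ t x, A₀ t x (timeDeriv u t x) + ∑ j, A j t x (partialDeriv j (u t) x) + B t x (u t x) = 0 := by
  -- derivative fields of `P`
  have hPt : IsSmoothSpaceTimeOn univ (timeDeriv P) := by
    have h := hP.timeDerivWithin uniqueDiffOn_univ
    rwa [timeDerivWithin_univ] at h
  have hPj : ∀ j, IsSmoothSpaceTimeOn univ fun t => partialDeriv j (P t) := fun j =>
    hP.partialDeriv uniqueDiffOn_univ j
  -- two-sided inverse identities
  have hPQA : ∀ t x (v : W), P t x (Q t x (A₀ t x v)) = v := fun t x =>
    clm_comp_eq_one_comm (P := P t x) (L := (Q t x).comp (A₀ t x)) (hQAP t x)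
  have hAPQ : ∀ t x (v : W), A₀ t x (P t x (Q t x v)) = v := fun t x v => by
    have h := clm_comp_eq_one_comm (P := (A₀ t x).comp (P t x)) (L := Q t x) (hQAP t x) v
    simpa using h
  -- adjoint of `Q`
  have hQP : ∀ t x (v w : W), ⟪Q t x v, w⟫_ℝ = ⟪v, P t x w⟫_ℝ := fun t x v w => by
    rw [real_inner_comm, ← hPQ, real_inner_comm]
  -- the coefficients of the symmetrised system (written out; no local definitions)
  have hA' : ∀ j, IsSmoothSpaceTimeOn univ (fun t x => -((Q t x).comp ((A j t x).comp (P t x)))) :=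
    fun j => by
    show ContDiffOn ℝ ∞ (fun p : ℝ × EuclideanSpace ℝ (Fin n) =>
      -((stLift Q p).comp ((stLift (A j) p).comp (stLift P p)))) (univ ×ˢ univ)
    exact (ContDiffOn.clm_comp hQ (ContDiffOn.clm_comp (hA j) hP)).neg
  have hB' : IsSmoothSpaceTimeOn univ (fun t x => -((Q t x).comp ((A₀ t x).comp (timeDeriv P t x) +
      (∑ j, (A j t x).comp (partialDeriv j (P t) x)) + (B t x).comp (P t x)))) := by
    show ContDiffOn ℝ ∞ (fun p : ℝ × EuclideanSpace ℝ (Fin n) =>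
      -((stLift Q p).comp ((stLift A₀ p).comp (stLift (timeDeriv P) p) +
        (∑ j, (stLift (A j) p).comp (stLift (fun t => partialDeriv j (P t)) p)) +
        (stLift B p).comp (stLift P p)))) (univ ×ˢ univ)
    refine (ContDiffOn.clm_comp hQ ((ContDiffOn.add (ContDiffOn.clm_comp hA₀ hPt) ?_).add
      (ContDiffOn.clm_comp hB hP))).neg
    exact ContDiffOn.sum fun j _ => ContDiffOn.clm_comp (hA j) (hPj j)
  have hsym' : ∀ j t x (v w : W), ⟪(-((Q t x).comp ((A j t x).comp (P t x)))) v, w⟫_ℝ =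
      ⟪v, (-((Q t x).comp ((A j t x).comp (P t x)))) w⟫_ℝ := by
    intro j t x v w
    simp only [neg_apply, ContinuousLinearMap.comp_apply, inner_neg_left, inner_neg_right, neg_inj]
    rw [hQP, hsym j t x, hPQ]
  -- the data and the solution of the symmetrised system
  have hw₀ : IsSmooth fun x => Q 0 x (A₀ 0 x (U₀ x)) :=
    isSmooth_clm_apply (hQ.isSmooth_slice (mem_univ 0))
      (isSmooth_clm_apply (hA₀.isSmooth_slice (mem_univ 0)) hU₀)
  obtain ⟨w, hw, hw0, hweq⟩ := exists_torus_linear_symmHyp_solution hA' hB' hsym' hw₀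
  refine ⟨fun t x => P t x (w t x), isSmoothSpaceTimeOn_clmApply hP hw, ?_, fun t x => ?_⟩
  · funext x
    show P 0 x (w 0 x) = U₀ x
    rw [hw0, hPQA]
  · -- the equation
    have hPs : IsSmooth (P t) := hP.isSmooth_slice (mem_univ t)
    have hws : IsSmooth (w t) := hw.isSmooth_slice (mem_univ t)
    have h1 : timeDeriv (fun s y => P s y (w s y)) t x =
        timeDeriv P t x (w t x) + P t x (timeDeriv w t x) := timeDeriv_clm_apply hP hw t x
    have h2 : ∀ j, partialDeriv j (fun y => P t y (w t y)) x =
        partialDeriv j (P t) x (w t x) + P t x (partialDeriv j (w t) x) := fun j =>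
      partialDeriv_clm_apply (hPs.isContDiff (by simp)) (hws.isContDiff (by simp)) j x
    rw [h1]
    simp_rw [h2]
    rw [hweq t x]
    simp only [neg_apply, sum_apply, add_apply, ContinuousLinearMap.comp_apply, map_add,
      map_neg, map_sum, Finset.sum_add_distrib, Finset.sum_neg_distrib, hAPQ]
    abel

end Symmetrised

end Literature.Analysis.PDE

end
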